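import Summits.AtomisticToContinuum.Crystallization.Theses.PerronTransitivity
import Summits.AtomisticToContinuum.Crystallization.Theses.PalmUnimodularRigidity
import Literature.Geometry.DiscreteGeometry.KissingPatterns

/-!
# Sketch — crux-ideate, ideator 1, crux `PerronTransitivity.UniformBindingRigidity` (stmt-AtomisticToContinuum-15099)

First lemmas of the two idea cards filed by this seat (they need not be proved here; they must
elaborate):

* card `zero-variance-hull-transfer`: `slack_le_surface` (slack of a uniformly bound set is a
  surface-order quantity — provable now from the landed finite floor
  `card_mul_iInf_le_interactionEnergy` and separation counting), the transfer target
  `ZeroVarianceShells` (= `PalmUnimodularRigidity.MinimiserShells` with the extra a.s. hypothesis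
  "root energy = 2e* exactly"), the soft bridge `HullZeroVarianceLaw`, and the density-level
  conclusion `HcpInDensity`.
* card `analytic-near-period-rigidity`: the pure-analysis core `signedPotential_eq_empty`
  (a finite signed Lennard-Jones potential vanishing on a relatively dense set is trivial — expansion
  at infinity + real-analytic continuation + poles) and its first consequence
  `finite_nearPeriod_eq` / `no_compact_defect` for EXACTLY uniformly bound sets.
-/

noncomputable section

namespace Summit.AtomisticToContinuum.Crystallization.Cruxes.UniformBindingRigidity.IdeatorOne

open Literature.MathematicalPhysics.StatisticalMechanics
open Summit.AtomisticToContinuum.Crystallization.Theses.PerronTransitivity (UniformBindingRigidity)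

/-- Euclidean 3-space. -/
abbrev E3 := EuclideanSpace ℝ (Fin 3)

/-- Lennard-Jones site energy `U_X(p) = Σ'_{q ∈ X, q ≠ p} V(dist p q)` (the crux's inlined term). -/
def siteSum (X : Set E3) (p : E3) : ℝ :=
  ∑' q : {q : E3 // q ∈ X ∧ q ≠ p}, lennardJones (dist p q.1)

/-- The level `2e*`, `e* = ⨅_Q e_LJ(Q)`. -/
def twoEStar : ℝ := 2 * ⨅ Q : PeriodicConfiguration 3, Q.energyPerParticle lennardJones

/-- Uniform binding (the crux hypothesis): every site bound at least as well as the crystal average. -/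
def UniformlyBound (X : Set E3) : Prop := ∀ p ∈ X, siteSum X p ≤ twoEStar

/-- Exact uniform binding (what `closes` actually consumes: the output of `TransitiveLocalLimit`). -/
def ExactlyBound (X : Set E3) : Prop := ∀ p ∈ X, siteSum X p = twoEStar

/-- `δ`-separation. -/
def Separated (δ : ℝ) (X : Set E3) : Prop := ∀ p ∈ X, ∀ q ∈ X, p ≠ q → δ ≤ dist p q

/-- Relative density (cohesion, the line's shared first stub). -/
def RelDense (X : Set E3) : Prop := ∃ R : ℝ, ∀ y : E3, ∃ p ∈ X, dist y p ≤ R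

/-! ## Card `zero-variance-hull-transfer` -/

/-- **First lemma (A1, provable now): slack is a surface-order quantity.** For a `δ`-separated
uniformly bound `X`, the total slack `Σ (2e* − U_X(p))` over the sites in any ball of radius `R` is
`≤ K R²`: finite floor `#S · e* ≤ 𝓔(S)` (landed `card_mul_iInf_le_interactionEnergy`) plus
`𝓔(S) = ½ Σ_{p ∈ S} U_X(p) − ½ C(S, X ∖ S)` and a separation bound on the cross term. Hence slack has
zero density and every translation-invariant law on the hull of `X` has root energy `2e*` a.s. -/
theorem slack_le_surface :
    ∀ δ : ℝ, 0 < δ → ∃ K : ℝ, ∀ X : Set E3, Separated δ X → UniformlyBound X →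
      ∀ (c : E3) (R : ℝ), 1 ≤ R → ∀ S : Finset E3, (∀ p ∈ S, p ∈ X ∧ dist p c ≤ R) →
        ∑ p ∈ S, (twoEStar - siteSum X p) ≤ K * R ^ 2 := by
  sorry

/-- **Transfer target (A2) `ZeroVarianceShells`**: `PalmUnimodularRigidity.MinimiserShells`
(stmt-9225) VERBATIM with one extra hypothesis inserted before the conclusion — ZERO VARIANCE,
`P`-a.s. `∫ V_LJ(‖y‖) dμ = 2e*` (every root bound exactly at the crystal average). Strictly weaker
than 9225. -/
def ZeroVarianceShells : Prop :=
  ∀ δ : ℝ, 0 < δ → ∀ P : MeasureTheory.Measure (MeasureTheory.Measure (EuclideanSpace ℝ (Fin 3))), MeasureTheory.IsProbabilityMeasure P → (∀ᵐ μ ∂P, (∃ S : Set (EuclideanSpace ℝ (Fin 3)), (0 : EuclideanSpace ℝ (Fin 3)) ∈ S ∧ (∀ x ∈ S, ∀ y ∈ S, x ≠ y → δ ≤ dist x y) ∧ μ = (MeasureTheory.Measure.count : MeasureTheory.Measure (EuclideanSpace ℝ (Fin 3))).restrict S)) → (∀ g : MeasureTheory.Measure (EuclideanSpace ℝ (Fin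 3)) → EuclideanSpace ℝ (Fin 3) → ENNReal, Measurable (Function.uncurry g) → ∫⁻ μ, ∫⁻ y, g μ y ∂μ ∂P = ∫⁻ μ, ∫⁻ y, g (MeasureTheory.Measure.map (fun z => z - y) μ) (-y) ∂μ ∂P) → (∫ μ, (∫ y, Literature.MathematicalPhysics.StatisticalMechanics.lennardJones ‖y‖ ∂μ) / 2 ∂P) ≤ (⨅ Q : Literature.MathematicalPhysics.StatisticalMechanics.PeriodicConfiguration 3, Q.energyPerParticle Literature.MathematicalPhysics.StatisticalMechanics.lennardJones) → (∀ᵐ μ ∂P, (∫ y, Literature.MathematicalPhysics.StatisticalMechanics.lennardJones ‖y‖ ∂μ) = 2 * ⨅ Q : Literature.MathematicalPhysics.StatisticalMechanics.PeriodicConfiguration 3, Q.energyPerParticle Literature.MathematicalPhysics.StatisticalMechanics.lennardJones) → ∀ᵐ μ ∂P, (∃ a : ℝ, 9 / 10 ≤ a ∧ a ≤ 1 ∧ ∃ T : Finset (EuclideanSpace ℝ (Fin 3)), (↑T : Set (EuclideanSpace ℝ (Fin 3))) = {y : EuclideanSpace ℝ (Fin 3) | μ {y} ≠ 0 ∧ y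 ≠ 0 ∧ ‖y‖ ≤ 5 / 4 * a} ∧ (Literature.Geometry.DiscreteGeometry.ShellCloseTo (a / 100) T (Finset.image (fun v : EuclideanSpace ℝ (Fin 3) => a • v) Literature.Geometry.DiscreteGeometry.fccKissingPattern) ∨ Literature.Geometry.DiscreteGeometry.ShellCloseTo (a / 100) T (Finset.image (fun v : EuclideanSpace ℝ (Fin 3) => a • v) Literature.Geometry.DiscreteGeometry.hcpKissingPattern)))

/-- Sanity: the sibling crux implies the zero-variance special case (drop a hypothesis). -/
theorem zeroVarianceShells_of_minimiserShells
    (h : Summit.AtomisticToContinuum.Crystallization.Theses.PalmUnimodularRigidity.MinimiserShells) :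
    ZeroVarianceShells := by
  intro δ hδ P hP hcore hstat hmin _hzv
  exact h δ hδ P hP hcore hstat hmin

/-- Two-way `ε`-matching of `S` with a translate of `X` on the ball `‖·‖ ≤ R` (hull membership at
finite precision; the clause shape of `TransitiveLocalLimit`). -/
def NearTranslate (X S : Set E3) (R ε : ℝ) : Prop :=
  ∃ v : E3, (∀ p ∈ S, ‖p‖ ≤ R → ∃ q ∈ X, dist (q + v) p ≤ ε) ∧
    (∀ q ∈ X, ‖q + v‖ ≤ R → ∃ p ∈ S, dist (q + v) p ≤ ε)

/-- `S` lies in the translation hull of `X`. -/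
def InHull (X S : Set E3) : Prop := ∀ R ε : ℝ, 0 < ε → NearTranslate X S R ε

/-- **Soft bridge (A3) `HullZeroVarianceLaw`**: Krylov–Bogolyubov on the compact translation hull of a
uniformly bound, separated, relatively dense `X`, Palm-ised at a typical point, gives a probability law
in the exact format of the Palm cruxes (rooted hard-core a.s., Mecke identity) which is carried by HULL
elements of `X`, is uniformly bound a.s. (closed condition, landed CohesionC), and has root energy
EXACTLY `2e*` a.s. (`slack_le_surface` + landed `unimodularEnergyLowerBound_proof`): a ZERO-VARIANCE
minimising law. -/
def HullZeroVarianceLaw : Prop :=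
  ∀ X : Set E3, X.Nonempty → ∀ δ : ℝ, 0 < δ → Separated δ X → UniformlyBound X → RelDense X →
    ∃ P : MeasureTheory.Measure (MeasureTheory.Measure E3), MeasureTheory.IsProbabilityMeasure P ∧
      (∀ᵐ μ ∂P, ∃ S : Set E3, (0 : E3) ∈ S ∧ Separated δ S ∧ InHull X S ∧ UniformlyBound S ∧
        μ = (MeasureTheory.Measure.count : MeasureTheory.Measure E3).restrict S) ∧
      (∀ g : MeasureTheory.Measure E3 → E3 → ENNReal, Measurable (Function.uncurry g) →
        ∫⁻ μ, ∫⁻ y, g μ y ∂μ ∂P = ∫⁻ μ, ∫⁻ y, g (MeasureTheory.Measure.map (fun z => z - y) μ) (-y) ∂μ ∂P) ∧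
      (∀ᵐ μ ∂P, (∫ y, lennardJones ‖y‖ ∂μ) = twoEStar)

/-- **Density-level conclusion of the card's law-level steps (A2 + proved 9227 + staffed 9226)**:
a uniformly bound Delone `X` coincides IN DENSITY with rigid images of relaxed hcp — for every
window radius and tolerance, hull elements two-way matched with NO rotated relaxed-hcp crystal occur
with zero frequency; stated here in its pointwise-in-the-hull form (every hull LAW is hcp a.s.), the
input of card `analytic-near-period-rigidity`'s return step. -/
def HcpInDensity : Prop :=
  ∀ X : Set E3, X.Nonempty → ∀ δ : ℝ, 0 < δ → Separated δ X → UniformlyBound X → RelDense X →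
    ∀ P : MeasureTheory.Measure (MeasureTheory.Measure E3), MeasureTheory.IsProbabilityMeasure P →
      (∀ᵐ μ ∂P, ∃ S : Set E3, (0 : E3) ∈ S ∧ Separated δ S ∧ InHull X S ∧
        μ = (MeasureTheory.Measure.count : MeasureTheory.Measure E3).restrict S) →
      (∀ g : MeasureTheory.Measure E3 → E3 → ENNReal, Measurable (Function.uncurry g) →
        ∫⁻ μ, ∫⁻ y, g μ y ∂μ ∂P = ∫⁻ μ, ∫⁻ y, g (MeasureTheory.Measure.map (fun z => z - y) μ) (-y) ∂μ ∂P) →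
      (∀ᵐ μ ∂P, (∫ y, lennardJones ‖y‖ ∂μ) = twoEStar) →
      ∀ᵐ μ ∂P, ∃ a h : ℝ, ∃ ha : a ≠ 0, ∃ hh : h ≠ 0, ∃ A : E3 ≃ₗᵢ[ℝ] E3,
        (hcpPeriodicConfiguration ha hh).energyPerParticle lennardJones =
            ⨅ Q : PeriodicConfiguration 3, Q.energyPerParticle lennardJones ∧
          μ = (MeasureTheory.Measure.count : MeasureTheory.Measure E3).restrict (A '' hcpStacking a h)

/-! ## Card `analytic-near-period-rigidity` -/

/-- **First lemma (B0, pure analysis): a finite signed Lennard-Jones potential that vanishes on a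
relatively dense set is trivial.** If `Dp, Dm` are disjoint finite sets and
`Φ(y) = Σ_{d ∈ Dp} V(dist y d) − Σ_{d ∈ Dm} V(dist y d)` vanishes at every point of a relatively dense
`Y` off `Dp ∪ Dm`, then `Dp = Dm = ∅`. Proof: `Φ` has a convergent expansion
`Σ_n a_n(ŷ) ‖y‖^{-6-n}` at infinity (Gegenbauer) with continuous `a_n`; a relatively dense set
meets every open cone unboundedly, so `a_n ≡ 0` by induction; `Φ ≡ 0` near infinity, hence on the
connected set `ℝ³ ∖ D` by real-analytic continuation; the pole `V → +∞` at a point of `Dp ∖ Dm`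
is then absurd. Infinite range and analyticity of `V_LJ` are used essentially
(ShortRangeStackingBlindness is the barrier this evades). -/
theorem signedPotential_eq_empty :
    ∀ Dp Dm : Finset E3, Disjoint Dp Dm → ∀ Y : Set E3, RelDense Y →
      (∀ y ∈ Y, y ∉ Dp → y ∉ Dm →
        ∑ d ∈ Dp, lennardJones (dist y d) = ∑ d ∈ Dm, lennardJones (dist y d)) →
      Dp = ∅ ∧ Dm = ∅ := by
  sorry

/-- **B1: finite near-periods of an exactly bound Delone set are exact periods.** If `X` is separated,
relatively dense and EXACTLY uniformly bound, and `X △ (X + t)` is finite, then `X + t = X`: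
for `p, p + t ∈ X` one has `0 = U_X(p) − U_X(p+t) = Φ(p)` with `Φ` the signed potential of
`Dp = X ∖ (X+t)`, `Dm = (X+t) ∖ X`, and `X ∩ (X − t)` is relatively dense; apply B0. The same
proof makes every isometry `g` with `X △ gX` finite an exact symmetry of `X`. -/
theorem finite_nearPeriod_eq :
    ∀ X : Set E3, (∃ δ : ℝ, 0 < δ ∧ Separated δ X) → RelDense X → ExactlyBound X →
      ∀ t : E3, (symmDiff X ((fun x => x + t) '' X)).Finite → (fun x => x + t) '' X = X := by
  sorry

/-- **B2: no compact defects at zero slack (k = 0 of the return step), WITHOUT formation energies.**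
An exactly bound, separated, relatively dense `X` that agrees with the point set of a periodic
configuration outside a bounded set IS that point set: every lattice vector is a finite near-period,
hence a period (B1), so `X` is invariant under a full-rank lattice and the bounded modification is
empty. (Contrast the refuter's defect bookkeeping, which needs strict GSC / positive formation energy.) -/
theorem no_compact_defect :
    ∀ (P : PeriodicConfiguration 3) (X : Set E3), (∃ δ : ℝ, 0 < δ ∧ Separated δ X) → RelDense X →
      ExactlyBound X → (∃ c : E3, ∃ r : ℝ, ∀ y : E3, r < dist y c → (y ∈ X ↔ y ∈ P.points)) →
      X = P.points := by
  sorry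

/-- The crux's hypothesis in this file's vocabulary (read-back, `Iff.rfl`-level). -/
theorem uniformBindingRigidity_iff :
    UniformBindingRigidity ↔
      ∀ X : Set E3, X.Nonempty → (∃ δ : ℝ, 0 < δ ∧ Separated δ X) → UniformlyBound X →
        ∃ P : PeriodicConfiguration 3, P.points = X ∧
          IsLeast (Set.range fun Q : PeriodicConfiguration 3 => Q.energyPerParticle lennardJones)
            (P.energyPerParticle lennardJones) :=
  Iff.rfl

end Summit.AtomisticToContinuum.Crystallization.Cruxes.UniformBindingRigidity.IdeatorOne

end
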